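import Summits.MatrixMultiplication.OmegaCensus.SmallFormats.MatMul22nColumnSubcomp
import HarnessLib

/-!
# ω-census family (a): the 4-term sub-computation of a loaded ROW plane (W-side twin of `MatMul22nColumnSubcomp`, any field)

Cell `pub-omega` (unit `pub-omega-tensor`, gen 40), topic `Summits/MatrixMultiplication/OmegaCensus` (sub-folder
`SmallFormats`). Framing (verbatim): lottery ticket; floor = certified bounds/negative ranges. HONEST FRAMING: the transpose-dual
(`exists_transposeDual'`: `(f, g, w) ↦ (f ∘ ᵀ, ⟨w, ·⟩, G)`) of `ColumnSubcomp.sees_cheap_input` / `double_cell_independent` (p736887):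
for a loaded ROW plane with cheap output vectors `c 0, c 1` (`loadedRowPlane_structure`: `∑_i c_m(i) (ν ᵥ* W_t)_i = 0` off the plane),
every term of the plane WRITES something the cheap functionals see (`RowSubcomp.sees_cheap_output`), and two terms with the same X-form
write linearly independent pairs (`RowSubcomp.double_cell_independent_w`). Nothing here is a bound on `ω`.
-/

namespace Summit.MatrixMultiplication.OmegaCensus.SmallFormats

open Finset Module Matrix
open Literature.Computability.AlgebraicComplexity
open Summit.MatrixMultiplication.OmegaCensus.RankOnePlaneCapGeneral

namespace RowSubcomp

variable {k : Type*} [Field k] {n : ℕ} {ι : Type*} [Fintype ι]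

/-- The cheap-output pairing as the transpose-dual's cheap-input value: if `g'(Y') = ∑ W κ j Y' κ j` then
`g'(ν xᵀ) = ∑_i x i (ν ᵥ* W) i`. -/
theorem pairing_eq (W : Matrix (Fin 2) (Fin n) k) (ν : Fin 2 → k) (x : Fin n → k) :
    (∑ κ, ∑ j, W κ j * Matrix.vecMulVec ν x κ j) = ∑ i, x i * (Matrix.vecMul ν W) i := by
  rw [Finset.sum_comm]
  refine Finset.sum_congr rfl fun j _ => ?_
  simp only [Matrix.vecMulVec_apply, Matrix.vecMul, dotProduct, Finset.mul_sum]
  exact Finset.sum_congr rfl fun κ _ => by ring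

/-- **Every term of a loaded row plane writes something seen by the cheap output functionals**: with `|S| = 4`, `ν ≠ 0`, `c` independent
and `∑_i c_m(i) (ν ᵥ* W_t)_i = 0` for every `t ∉ S`, each `s ∈ S` has `∑_i c_m(i) (ν ᵥ* W_s)_i ≠ 0` for some `m`. -/
theorem sees_cheap_output (β : BilinComp (mulBilin k 2 2 n) ι) (ν : Fin 2 → k) (hν : ν ≠ 0) (S : Finset ι) (hS4 : S.card = 4)
    (c : Fin 2 → (Fin n → k)) (hind : ∀ a : Fin 2 → k, ∑ m, a m • c m = 0 → ∀ m, a m = 0)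
    (hcheap : ∀ t, t ∉ S → ∀ m, ∑ i, c m i * (Matrix.vecMul ν (β.w t)) i = 0) (s₀ : ι) (hs₀ : s₀ ∈ S) :
    ∃ m, ∑ i, c m i * (Matrix.vecMul ν (β.w s₀)) i ≠ 0 := by
  classical
  obtain ⟨β', -, hg, -⟩ := exists_transposeDual' β
  have hg' : ∀ t m, β'.g t (Matrix.vecMulVec ν (c m)) = ∑ i, c m i * (Matrix.vecMul ν (β.w t)) i := by
    intro t m; rw [hg, pairing_eq]
  have hcheap' : ∀ t, t ∉ S → ∀ m, β'.g t (Matrix.vecMulVec ν (c m)) = 0 := by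
    intro t ht m; rw [hg']; exact hcheap t ht m
  obtain ⟨m, hm⟩ := ColumnSubcomp.sees_cheap_input β' ν hν S hS4 c hind hcheap' s₀ hs₀
  exact ⟨m, by rwa [hg'] at hm⟩

/-- **A double cell writes twice**: two distinct terms of `S` with the same X-form have linearly independent pairs
`(∑_i c_m(i) (ν ᵥ* W_s)_i)_{m = 0,1}`. -/
theorem double_cell_independent_w (β : BilinComp (mulBilin k 2 2 n) ι) (ν : Fin 2 → k) (hν : ν ≠ 0) (S : Finset ι)
    (hS4 : S.card = 4) (c : Fin 2 → (Fin n → k)) (hind : ∀ a : Fin 2 → k, ∑ m, a m • c m = 0 → ∀ m, a m = 0)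
    (hcheap : ∀ t, t ∉ S → ∀ m, ∑ i, c m i * (Matrix.vecMul ν (β.w t)) i = 0) (s₁ s₂ : ι) (hs₁ : s₁ ∈ S) (hs₂ : s₂ ∈ S)
    (hne : s₁ ≠ s₂) (hf : β.f s₁ = β.f s₂) (a₁ a₂ : k)
    (hrel : ∀ m, a₁ * (∑ i, c m i * (Matrix.vecMul ν (β.w s₁)) i) + a₂ * (∑ i, c m i * (Matrix.vecMul ν (β.w s₂)) i) = 0) :
    a₁ = 0 ∧ a₂ = 0 := by
  classical
  obtain ⟨β', hf', hg, -⟩ := exists_transposeDual' β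
  have hg' : ∀ t m, β'.g t (Matrix.vecMulVec ν (c m)) = ∑ i, c m i * (Matrix.vecMul ν (β.w t)) i := by
    intro t m; rw [hg, pairing_eq]
  have hcheap' : ∀ t, t ∉ S → ∀ m, β'.g t (Matrix.vecMulVec ν (c m)) = 0 := by
    intro t ht m; rw [hg']; exact hcheap t ht m
  have hff : β'.f s₁ = β'.f s₂ := by
    ext X'
    rw [hf', hf', hf]
  refine ColumnSubcomp.double_cell_independent β' ν hν S hS4 c hind hcheap' s₁ s₂ hs₁ hs₂ hne hff a₁ a₂ fun m => ?_
  rw [hg', hg']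
  exact hrel m

end RowSubcomp

end Summit.MatrixMultiplication.OmegaCensus.SmallFormats
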